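import Summits.AtomisticToContinuum.FouriersLaw.Theorems.ParityLiouvilleSeedLiouvilleForHeatHarmonicDefs
import Mathlib.Probability.Independence.InfinitePi
import Mathlib.Probability.Independence.Integration
import Mathlib.Probability.Moments.Variance

/-!
# The radiating Gaussian state of the harmonic chain: noise calculus and covariances

Helper file for the harmonic tightness witness of `ParityLiouvilleSeed.LiouvilleForHeat`
(`stmt-AtomisticToContinuum-13980`) / `ZeroCurrentRigidity` (`stmt-AtomisticToContinuum-12073`);
see `ParityLiouvilleSeedLiouvilleForHeatHarmonicDefs` for the objects.

Contents: the coordinates of the noise are independent centred Gaussians (`map_eval_noiseMeasure`,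
`iIndepFun_eval`, `integral_eval_mul_eval`); every field coordinate is in every `L^p`
(`memLp_gaussFieldP`); the second moments of the field,
`E q_x q_y = [x = y]`, `E q_a p_y = ([a = y+1] - [a = y-1])/2`,
`E p_x p_y = (ω₂ + 2)[x = y] - [y + 1 = x] - [y - 1 = x]` (`integral_q_mul_q`, `integral_q_mul_p`,
`integral_p_mul_p`) — the covariance `C` of the blueprint, with `Q = I`, `P = Ω² = ω₂ - Δ`,
`M` antisymmetric of range one.
-/

noncomputable section

open MeasureTheory ProbabilityTheory
open scoped NNReal ENNReal
open Literature.MathematicalPhysics.KineticTheory.HeatConduction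

namespace Summit.AtomisticToContinuum.FouriersLaw.Theorems.ParityLiouvilleSeed.HarmonicWitness

variable (ω₂ : ℝ)

/-! ### The coordinates of the noise -/

/-- Each noise coordinate is a centred Gaussian of the prescribed variance. [folklore] -/
theorem map_eval_noiseMeasure (k : Idx) :
    (noiseMeasure ω₂).map (fun ζ : Src => ζ k) = gaussianReal 0 (noiseVar ω₂ k.2) := by
  unfold noiseMeasure
  exact (measurePreserving_eval_infinitePi (fun k : Idx => gaussianReal 0 (noiseVar ω₂ k.2)) k).map_eq

/-- Noise coordinates are in every `L^p`, `p < ∞`. [folklore] -/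
theorem memLp_eval (k : Idx) (p : ℝ≥0∞) (hp : p ≠ ∞) :
    MemLp (fun ζ : Src => ζ k) p (noiseMeasure ω₂) := by
  have h : MemLp id p ((noiseMeasure ω₂).map fun ζ : Src => ζ k) := by
    rw [map_eval_noiseMeasure]; exact memLp_id_gaussianReal' p hp
  exact h.comp_of_map (measurable_pi_apply k).aemeasurable

/-- Noise coordinates are integrable. [folklore] -/
theorem integrable_eval (k : Idx) : Integrable (fun ζ : Src => ζ k) (noiseMeasure ω₂) :=
  (memLp_eval ω₂ k 1 (by simp)).integrable le_rfl

/-- Products of two noise coordinates are integrable. [folklore] -/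
theorem integrable_eval_mul_eval (k l : Idx) :
    Integrable (fun ζ : Src => ζ k * ζ l) (noiseMeasure ω₂) :=
  (memLp_eval ω₂ k 2 (by simp)).integrable_mul (memLp_eval ω₂ l 2 (by simp))

/-- Noise coordinates are centred. [folklore] -/
theorem integral_eval (k : Idx) : ∫ ζ, ζ k ∂noiseMeasure ω₂ = 0 := by
  have h := integral_map (μ := noiseMeasure ω₂) (φ := fun ζ : Src => ζ k)
    (measurable_pi_apply k).aemeasurable (f := fun x : ℝ => x) aestronglyMeasurable_id
  rw [map_eval_noiseMeasure, integral_id_gaussianReal] at h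
  exact h.symm

/-- The variance of a noise coordinate. [folklore] -/
theorem variance_eval (k : Idx) :
    Var[fun ζ : Src => ζ k; noiseMeasure ω₂] = (noiseVar ω₂ k.2 : ℝ) := by
  have hv := variance_map (μ := noiseMeasure ω₂) (X := fun x : ℝ => x) (Y := fun ζ : Src => ζ k)
    aemeasurable_id (measurable_pi_apply k).aemeasurable
  rw [map_eval_noiseMeasure, variance_fun_id_gaussianReal] at hv
  exact hv.symm

/-- The second moment of a noise coordinate is its variance. [folklore] -/
theorem integral_eval_sq (k : Idx) :
    ∫ ζ, ζ k ^ 2 ∂noiseMeasure ω₂ = (noiseVar ω₂ k.2 : ℝ) := by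
  have h := variance_eq_sub (μ := noiseMeasure ω₂) (memLp_eval ω₂ k 2 (by simp))
  rw [variance_eval, integral_eval] at h
  simp only [ne_eq, OfNat.ofNat_ne_zero, not_false_eq_true, zero_pow, sub_zero] at h
  rw [h]
  rfl

/-- The noise coordinates are mutually independent. [folklore] -/
theorem iIndepFun_eval : iIndepFun (fun (k : Idx) (ζ : Src) => ζ k) (noiseMeasure ω₂) := by
  unfold noiseMeasure
  exact iIndepFun_infinitePi (P := fun k : Idx => gaussianReal 0 (noiseVar ω₂ k.2))
    (X := fun _ x => x) fun _ => measurable_id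

/-- **Orthogonality of the noise**: `E ζ_k ζ_l = v_k [k = l]`. [folklore] -/
theorem integral_eval_mul_eval (k l : Idx) :
    ∫ ζ, ζ k * ζ l ∂noiseMeasure ω₂ = if k = l then (noiseVar ω₂ k.2 : ℝ) else 0 := by
  split_ifs with h
  · subst h
    simp_rw [← pow_two]
    exact integral_eval_sq ω₂ k
  · rw [((iIndepFun_eval ω₂).indepFun h).integral_fun_mul_eq_mul_integral
        (measurable_pi_apply k).aestronglyMeasurable (measurable_pi_apply l).aestronglyMeasurable]
    show (∫ ζ, ζ k ∂noiseMeasure ω₂) * (∫ ζ, ζ l ∂noiseMeasure ω₂) = 0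
    rw [integral_eval, zero_mul]

/-- Orthogonality of the noise, site/species form: `E ζ_(a,s) ζ_(b,t) = v_s [a = b ∧ s = t]`.
[folklore] -/
theorem integral_xi_mul_xi (a b : ℤ) (s t : Fin 3) :
    ∫ ζ, ζ (a, s) * ζ (b, t) ∂noiseMeasure ω₂ = if a = b ∧ s = t then (noiseVar ω₂ s : ℝ) else 0 := by
  rw [integral_eval_mul_eval]
  by_cases h : a = b ∧ s = t
  · rw [if_pos h, if_pos (Prod.ext h.1 h.2)]
  · rw [if_neg h, if_neg (fun e => h ⟨(Prod.ext_iff.1 e).1, (Prod.ext_iff.1 e).2⟩)]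

/-- The three variances: `v₀ = 1`. [folklore] -/
@[simp] theorem noiseVar_zero : noiseVar ω₂ 0 = 1 := by simp [noiseVar]

/-- The three variances: `v₂ = 1`. [folklore] -/
@[simp] theorem noiseVar_two : noiseVar ω₂ 2 = 1 := by simp [noiseVar]

/-- The three variances: `v₁ = ω₂⁺`. [folklore] -/
@[simp] theorem noiseVar_one : noiseVar ω₂ 1 = ω₂.toNNReal := by simp [noiseVar]

/-- For `ω₂ ≥ 0` the momentum noise has variance `ω₂`. [folklore] -/
theorem coe_noiseVar_one {ω₂ : ℝ} (hω : 0 ≤ ω₂) : ((noiseVar ω₂ 1 : ℝ≥0) : ℝ) = ω₂ := by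
  rw [noiseVar_one, Real.coe_toNNReal _ hω]

/-! ### Integrability of the field coordinates -/

/-- The momentum coordinates of the field are in every `L^p`, `p < ∞` (finite sums of Gaussians).
[folklore] -/
theorem memLp_gaussFieldP (x : ℤ) (p : ℝ≥0∞) (hp : p ≠ ∞) :
    MemLp (fun ζ : Src => gaussFieldP ζ x) p (noiseMeasure ω₂) := by
  have h := fun k => memLp_eval ω₂ k p hp
  have e : (fun ζ : Src => gaussFieldP ζ x) = fun ζ =>
      (1 / 2) * (ζ (x + 1, 0) - ζ (x - 1, 0)) + ζ (x, 1) +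
        (1 / 2) * (ζ (x, 2) - 2 * ζ (x - 1, 2) + ζ (x - 2, 2)) := by
    funext ζ; unfold gaussFieldP; ring
  rw [e]
  exact ((((h _).sub (h _)).const_mul _).add (h _)).add
    ((((h _).sub ((h _).const_mul 2)).add (h _)).const_mul _)

/-- The position coordinates of the field are in every `L^p`, `p < ∞`. [folklore] -/
theorem memLp_gaussField_fst (x : ℤ) (p : ℝ≥0∞) (hp : p ≠ ∞) :
    MemLp (fun ζ : Src => (gaussField ζ x).1) p (noiseMeasure ω₂) :=
  memLp_eval ω₂ (x, 0) p hp

/-- The momentum coordinates of the field are in every `L^p`, `p < ∞`. [folklore] -/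
theorem memLp_gaussField_snd (x : ℤ) (p : ℝ≥0∞) (hp : p ≠ ∞) :
    MemLp (fun ζ : Src => (gaussField ζ x).2) p (noiseMeasure ω₂) :=
  memLp_gaussFieldP ω₂ x p hp

/-- Linearity of the integral for the six-term shape of `gaussFieldP`. [folklore] -/
theorem integral_comb6 {α : Type*} [MeasurableSpace α] {μ : Measure α} {f₁ f₂ f₃ f₄ f₅ f₆ : α → ℝ}
    (h₁ : Integrable f₁ μ) (h₂ : Integrable f₂ μ) (h₃ : Integrable f₃ μ) (h₄ : Integrable f₄ μ)
    (h₅ : Integrable f₅ μ) (h₆ : Integrable f₆ μ) :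
    ∫ a, ((f₁ a - f₂ a) / 2 + f₃ a + (f₄ a - 2 * f₅ a + f₆ a) / 2) ∂μ =
      ((∫ a, f₁ a ∂μ) - ∫ a, f₂ a ∂μ) / 2 + ∫ a, f₃ a ∂μ +
        ((∫ a, f₄ a ∂μ) - 2 * ∫ a, f₅ a ∂μ + ∫ a, f₆ a ∂μ) / 2 := by
  have h12 : Integrable (fun a => (f₁ a - f₂ a) / 2) μ := (h₁.sub h₂).div_const 2
  have h5' : Integrable (fun a => 2 * f₅ a) μ := h₅.const_mul 2
  have h45 : Integrable (fun a => f₄ a - 2 * f₅ a) μ := h₄.sub h5'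
  have h456' : Integrable (fun a => f₄ a - 2 * f₅ a + f₆ a) μ := h45.add h₆
  have h456 : Integrable (fun a => (f₄ a - 2 * f₅ a + f₆ a) / 2) μ := h456'.div_const 2
  have hA : Integrable (fun a => (f₁ a - f₂ a) / 2 + f₃ a) μ := h12.add h₃
  rw [integral_add hA h456, integral_add h12 h₃, integral_div, integral_sub h₁ h₂, integral_div,
    integral_add h45 h₆, integral_sub h₄ h5', integral_const_mul]

/-! ### Second moments of the field -/

/-- `E ζ_k p_y`: the momentum `p_y` correlates with `ξ_{y±1}` (`±1/2`), `η_y` (`v₁`) and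
`ζ'_y, ζ'_{y-1}, ζ'_{y-2}` (`1/2, -1, 1/2`). [folklore] -/
theorem integral_xi_mul_gaussFieldP (a : ℤ) (s : Fin 3) (y : ℤ) :
    ∫ ζ, ζ (a, s) * gaussFieldP ζ y ∂noiseMeasure ω₂ =
      ((if a = y + 1 ∧ s = 0 then (noiseVar ω₂ s : ℝ) else 0) -
          (if a = y - 1 ∧ s = 0 then (noiseVar ω₂ s : ℝ) else 0)) / 2 +
        (if a = y ∧ s = 1 then (noiseVar ω₂ s : ℝ) else 0) +
        ((if a = y ∧ s = 2 then (noiseVar ω₂ s : ℝ) else 0) -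
            2 * (if a = y - 1 ∧ s = 2 then (noiseVar ω₂ s : ℝ) else 0) +
          (if a = y - 2 ∧ s = 2 then (noiseVar ω₂ s : ℝ) else 0)) / 2 := by
  have I := fun b t => integral_xi_mul_xi ω₂ a b s t
  have hI := fun l => integrable_eval_mul_eval ω₂ (a, s) l
  have e : ∀ ζ : Src, ζ (a, s) * gaussFieldP ζ y =
      (ζ (a, s) * ζ (y + 1, 0) - ζ (a, s) * ζ (y - 1, 0)) / 2 + ζ (a, s) * ζ (y, 1) +
        (ζ (a, s) * ζ (y, 2) - 2 * (ζ (a, s) * ζ (y - 1, 2)) + ζ (a, s) * ζ (y - 2, 2)) / 2 := by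
    intro ζ; unfold gaussFieldP; ring
  simp_rw [e]
  rw [integral_comb6 (hI _) (hI _) (hI _) (hI _) (hI _) (hI _), I, I, I, I, I, I]

/-- **`E q_x q_y = [x = y]`** (`Q = I`). [folklore] -/
theorem integral_q_mul_q (x y : ℤ) :
    ∫ ζ, (gaussField ζ x).1 * (gaussField ζ y).1 ∂noiseMeasure ω₂ = if x = y then 1 else 0 := by
  simp only [gaussField_apply_fst]
  rw [integral_xi_mul_xi]
  simp

/-- **`E q_a p_y = ([a = y + 1] - [a = y - 1]) / 2`** (`M` antisymmetric of range one).
[folklore] -/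
theorem integral_q_mul_p (a y : ℤ) :
    ∫ ζ, (gaussField ζ a).1 * (gaussField ζ y).2 ∂noiseMeasure ω₂ =
      ((if a = y + 1 then 1 else 0) - (if a = y - 1 then 1 else 0)) / 2 := by
  simp only [gaussField_apply_fst, gaussField_apply_snd]
  rw [integral_xi_mul_gaussFieldP]
  simp

/-- `E p_x ζ_k` in the form needed for `E p_x p_y`: the six coordinate integrals of `gaussFieldP ζ x`
against a momentum coordinate. [folklore] -/
theorem integral_gaussFieldP_mul_gaussFieldP_raw (x y : ℤ) :
    ∫ ζ, gaussFieldP ζ x * gaussFieldP ζ y ∂noiseMeasure ω₂ =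
      ((∫ ζ, ζ (x + 1, 0) * gaussFieldP ζ y ∂noiseMeasure ω₂) -
          ∫ ζ, ζ (x - 1, 0) * gaussFieldP ζ y ∂noiseMeasure ω₂) / 2 +
        (∫ ζ, ζ (x, 1) * gaussFieldP ζ y ∂noiseMeasure ω₂) +
        ((∫ ζ, ζ (x, 2) * gaussFieldP ζ y ∂noiseMeasure ω₂) -
            2 * (∫ ζ, ζ (x - 1, 2) * gaussFieldP ζ y ∂noiseMeasure ω₂) +
          ∫ ζ, ζ (x - 2, 2) * gaussFieldP ζ y ∂noiseMeasure ω₂) / 2 := by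
  have hI : ∀ k : Idx, Integrable (fun ζ : Src => ζ k * gaussFieldP ζ y) (noiseMeasure ω₂) := fun k =>
    (memLp_eval ω₂ k 2 (by simp)).integrable_mul (memLp_gaussFieldP ω₂ y 2 (by simp))
  have e : ∀ ζ : Src, gaussFieldP ζ x * gaussFieldP ζ y =
      (ζ (x + 1, 0) * gaussFieldP ζ y - ζ (x - 1, 0) * gaussFieldP ζ y) / 2 +
        ζ (x, 1) * gaussFieldP ζ y +
        (ζ (x, 2) * gaussFieldP ζ y - 2 * (ζ (x - 1, 2) * gaussFieldP ζ y) +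
          ζ (x - 2, 2) * gaussFieldP ζ y) / 2 := by
    intro ζ; conv_lhs => rw [gaussFieldP]
    ring
  simp_rw [e]
  exact integral_comb6 (hI _) (hI _) (hI _) (hI _) (hI _) (hI _)

/-- **`E p_x p_y = (v₁ + 2)[x = y] - [y + 1 = x] - [y - 1 = x]`** (`P = Ω² = ω₂ - Δ` for
`ω₂ ≥ 0`), in the form matching `-E[F_y q_x]`. [folklore] -/
theorem integral_p_mul_p (x y : ℤ) :
    ∫ ζ, (gaussField ζ x).2 * (gaussField ζ y).2 ∂noiseMeasure ω₂ =
      ((noiseVar ω₂ 1 : ℝ) + 2) * (if y = x then 1 else 0) - (if y + 1 = x then 1 else 0) -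
        (if y - 1 = x then 1 else 0) := by
  simp only [gaussField_apply_snd]
  rw [integral_gaussFieldP_mul_gaussFieldP_raw]
  simp only [integral_xi_mul_gaussFieldP, noiseVar_zero, noiseVar_two, NNReal.coe_one, Fin.isValue,
    and_true, one_ne_zero, and_false, if_false, zero_ne_one, Fin.reduceEq, sub_zero, zero_add,
    zero_div, add_zero, mul_zero]
  obtain ⟨d, rfl⟩ : ∃ d : ℤ, y = x + d := ⟨y - x, by ring⟩
  have h1 : ∀ a b : ℤ, (x + a = x + d + b ↔ d = a - b) := fun a b => by constructor <;> intro h <;> omega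
  have h4 : (x = x + d ↔ d = 0) := by constructor <;> intro h <;> omega
  have h5 : ∀ a b : ℤ, (x - a = x + d + b ↔ d = -a - b) := fun a b => by
    constructor <;> intro h <;> omega
  have h6 : ∀ a : ℤ, (x - a = x + d ↔ d = -a) := fun a => by constructor <;> intro h <;> omega
  have h7 : ∀ a b : ℤ, (x + a = x + d - b ↔ d = a + b) := fun a b => by constructor <;> intro h <;> omega
  have h8 : ∀ b : ℤ, (x = x + d - b ↔ d = b) := fun b => by constructor <;> intro h <;> omega
  have h9 : ∀ a b : ℤ, (x - a = x + d - b ↔ d = b - a) := fun a b => by constructor <;> intro h <;> omega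
  have h10 : ∀ b : ℤ, (x + d + b = x ↔ d = -b) := fun b => by constructor <;> intro h <;> omega
  have h11 : ∀ b : ℤ, (x + d - b = x ↔ d = b) := fun b => by constructor <;> intro h <;> omega
  have h12 : (x + d = x ↔ d = 0) := by constructor <;> intro h <;> omega
  simp only [h1, h4, h5, h6, h7, h8, h9, h10, h11, h12]
  norm_num
  split_ifs <;> first | (exfalso; omega) | ring

end Summit.AtomisticToContinuum.FouriersLaw.Theorems.ParityLiouvilleSeed.HarmonicWitness

end
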